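import Summits.ValiantsHypothesis.ValiantsHypothesis.Theorems.MatrixDescartes.Negative.MatrixDescartesFalseOfTropicalMonster

/-!
# Route «KPlusLogSqLaw», crux `TropicalB` (stmt-ValiantsHypothesis-19771) — CYCLEWISE MONOTONICITY of dominant chains

HONEST FRAMING.  Helper file for the registered stubs `stub_tropThin` / `stub_tropFat` of `Cruxes/TropicalB/Lines/birth.lean`
(crux `TropicalB`, route `KPlusLogSqLaw`; cell `pub-symmetroid`).  A STRUCTURAL lemma on dominance designs valid at every format —
no bound on the tropical census is claimed, nothing on `TropicalB` in its window, `Lifting`, `MatrixDescartes`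
(stmt-ValiantsHypothesis-18050) or VP ≠ VNP.

§1 is the kernel-checked scratch lemma `sum_d_lt_of_isDominant_exchange` of the custody seat conjb-2 g4
(`HOME/pub-symmetroid-conjb-2/g4/CycleMonotone.lean`, sha16 ee42142a9ccdba46, ROUND1c-MEMO-g4 §2(e); offered to the prover
seats, INBOX l.6573 (a) / desk R1353 (2)), landed VERBATIM (namespace renamed, `import Mathlib` narrowed) by seat val-sym-trop-p4 (g2):
if `q₁` is dominant at `θ₁` and `q₂` at `θ₂ > θ₁`, and `r₁ ≠ q₁`, `r₂` are the terms obtained by EXCHANGING a column set `T` between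
them (entries travel with their classes), then the exponent mass of `q₂` on `T` strictly exceeds that of `q₁` on `T`.  Proof: add
the two dominance inequalities against `r₁` (at `θ₁`) and `r₂` (at `θ₂`); the valuation parts cancel.

§2 makes it designer-facing (this seat): for chain terms `(σ₁, λ₁) ≺ (σ₂, λ₂)` and ANY column set `T` invariant under the
quotient `σ₁⁻¹σ₂` (equivalently `σ₁ '' T = σ₂ '' T`: a union of cycles of the quotient plus common columns), the exchanged terms
ARE Leibniz terms — permutations `σ₁·π_T`, `σ₂·π_T⁻¹` with `π_T = ofSubtype (subtypePerm (σ₁⁻¹σ₂))` — so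
* `sum_d_lt_of_isDominant_invariant` — if the two terms differ somewhere on `T` then `∑_{b∈T} d(λ₁ b) < ∑_{b∈T} d(λ₂ b)`;
* `sum_d_lt_of_isDominant_split`     — `Tᶜ` is invariant too: if the terms differ both on `T` and off `T`, BOTH masses rise.
Special cases already in the tree (not restated): `T = univ` is slope monotonicity (`TropicalCensus.slope_lt_of_dominant`),
`T = {b}` with `σ₁ b = σ₂ b` is `TropicalCensus.d_lt_of_isDominant_of_sameEntry` (lift-p3) / `d_lt_of_dominant` (column
monotonicity for a fixed permutation).  READING (lift-p2 g2's located design rule, INBOX l.6726, now kernel-backed): two «digits»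
of a candidate family that act on DISJOINT invariant column sets must EACH raise exponent mass between ANY two chain terms,
consecutive or not — anti-monotone phase pairs kill such families; a super-counting family needs its digits entangled on common
cycles.  [folklore] exchange argument for parametric assignment (the `r = 2` case of the exchange criterion).
-/

set_option linter.dupNamespace false
set_option autoImplicit false

namespace Summit.ValiantsHypothesis.ValiantsHypothesis.Theorems.KPlusLogSqLaw

open Summit.ValiantsHypothesis.ValiantsHypothesis.Theorems.MatrixDescartes.Negative
open scoped BigOperators

/-! ## §1 The exchange lemma (conjb-2 g4, verbatim) -/

/-- **Cyclewise monotonicity (exchange form).**  If `q₁` is dominant at `θ₁`, `q₂` at `θ₂ > θ₁`, and `r₁ ≠ q₁`, `r₂` are obtained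
from `q₁`, `q₂` by exchanging the (row, class) data on the column set `T`, then `∑_{b∈T} d(q₁.2 b) < ∑_{b∈T} d(q₂.2 b)`.
[folklore; kernel text by conjb-2 g4, `g4/CycleMonotone.lean` ee42142a9ccdba46] -/
theorem sum_d_lt_of_isDominant_exchange {m K : ℕ} (d : Fin K → ℕ) (v ε : Fin m → Fin m → Fin K → ℤ) {θ₁ θ₂ : ℤ}
    (hθ : θ₁ < θ₂) {q₁ q₂ r₁ r₂ : Equiv.Perm (Fin m) × (Fin m → Fin K)}
    (h₁ : IsDominant d v ε θ₁ q₁) (h₂ : IsDominant d v ε θ₂ q₂) (T : Finset (Fin m))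
    (hr₁T : ∀ b ∈ T, r₁.1 b = q₂.1 b ∧ r₁.2 b = q₂.2 b) (hr₁ : ∀ b ∉ T, r₁.1 b = q₁.1 b ∧ r₁.2 b = q₁.2 b)
    (hr₂T : ∀ b ∈ T, r₂.1 b = q₁.1 b ∧ r₂.2 b = q₁.2 b) (hr₂ : ∀ b ∉ T, r₂.1 b = q₂.1 b ∧ r₂.2 b = q₂.2 b)
    (hne : r₁ ≠ q₁) :
    ∑ b ∈ T, (d (q₁.2 b) : ℤ) < ∑ b ∈ T, (d (q₂.2 b) : ℤ) := by
  obtain ⟨σ₁, l₁⟩ := q₁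
  obtain ⟨σ₂, l₂⟩ := q₂
  obtain ⟨ρ₁, k₁⟩ := r₁
  obtain ⟨ρ₂, k₂⟩ := r₂
  dsimp only at hr₁T hr₁ hr₂T hr₂ ⊢
  -- every entry of a present term is present
  have pres : ∀ (σ : Equiv.Perm (Fin m)) (l : Fin m → Fin K), termSign ε (σ, l) ≠ 0 → ∀ b, ε (σ b) b (l b) ≠ 0 := by
    intro σ l h b
    unfold termSign at h
    exact (Finset.prod_ne_zero_iff.mp (mul_ne_zero_iff.mp h).2) b (Finset.mem_univ _)
  have hp₁ := pres σ₁ l₁ h₁.1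
  have hp₂ := pres σ₂ l₂ h₂.1
  -- the exchanged terms are present
  have mkpres : ∀ (ρ : Equiv.Perm (Fin m)) (k : Fin m → Fin K), (∀ b, ε (ρ b) b (k b) ≠ 0) → termSign ε (ρ, k) ≠ 0 := by
    intro ρ k h
    unfold termSign
    refine mul_ne_zero (Units.ne_zero _) ?_
    rw [Finset.prod_ne_zero_iff]
    intro b _
    exact h b
  have hr₁pres : termSign ε (ρ₁, k₁) ≠ 0 := by
    refine mkpres ρ₁ k₁ fun b => ?_
    by_cases hb : b ∈ T
    · rw [(hr₁T b hb).1, (hr₁T b hb).2]; exact hp₂ b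
    · rw [(hr₁ b hb).1, (hr₁ b hb).2]; exact hp₁ b
  have hr₂pres : termSign ε (ρ₂, k₂) ≠ 0 := by
    refine mkpres ρ₂ k₂ fun b => ?_
    by_cases hb : b ∈ T
    · rw [(hr₂T b hb).1, (hr₂T b hb).2]; exact hp₁ b
    · rw [(hr₂ b hb).1, (hr₂ b hb).2]; exact hp₂ b
  -- r₂ ≠ q₂ (else r₁ = q₁)
  have hne₂ : (ρ₂, k₂) ≠ (σ₂, l₂) := by
    intro h
    apply hne
    have hρ : ρ₂ = σ₂ := congrArg Prod.fst h
    have hk : k₂ = l₂ := congrArg Prod.snd h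
    refine Prod.ext (Equiv.ext fun b => ?_) (funext fun b => ?_)
    · by_cases hb : b ∈ T
      · rw [(hr₁T b hb).1, ← (hr₂T b hb).1, hρ]
      · exact (hr₁ b hb).1
    · dsimp only
      by_cases hb : b ∈ T
      · rw [(hr₁T b hb).2, ← (hr₂T b hb).2, hk]
      · exact (hr₁ b hb).2
  have hA := h₁.2 _ hne hr₁pres
  have hB := h₂.2 _ hne₂ hr₂pres
  unfold tropWeight at hA hB
  dsimp only at hA hB
  -- split every sum over T and Tᶜ and identify the exchanged pieces
  have sd₁ : ∑ i, (d (k₁ i) : ℤ) = ∑ b ∈ T, (d (l₂ b) : ℤ) + ∑ b ∈ Tᶜ, (d (l₁ b) : ℤ) := by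
    rw [← Finset.sum_add_sum_compl T]
    congr 1
    · exact Finset.sum_congr rfl fun b hb => by rw [(hr₁T b hb).2]
    · exact Finset.sum_congr rfl fun b hb => by rw [(hr₁ b (Finset.mem_compl.mp hb)).2]
  have sv₁ : ∑ i, v (ρ₁ i) i (k₁ i) = ∑ b ∈ T, v (σ₂ b) b (l₂ b) + ∑ b ∈ Tᶜ, v (σ₁ b) b (l₁ b) := by
    rw [← Finset.sum_add_sum_compl T]
    congr 1
    · exact Finset.sum_congr rfl fun b hb => by rw [(hr₁T b hb).1, (hr₁T b hb).2]
    · exact Finset.sum_congr rfl fun b hb => by rw [(hr₁ b (Finset.mem_compl.mp hb)).1, (hr₁ b (Finset.mem_compl.mp hb)).2]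
  have sd₂ : ∑ i, (d (k₂ i) : ℤ) = ∑ b ∈ T, (d (l₁ b) : ℤ) + ∑ b ∈ Tᶜ, (d (l₂ b) : ℤ) := by
    rw [← Finset.sum_add_sum_compl T]
    congr 1
    · exact Finset.sum_congr rfl fun b hb => by rw [(hr₂T b hb).2]
    · exact Finset.sum_congr rfl fun b hb => by rw [(hr₂ b (Finset.mem_compl.mp hb)).2]
  have sv₂ : ∑ i, v (ρ₂ i) i (k₂ i) = ∑ b ∈ T, v (σ₁ b) b (l₁ b) + ∑ b ∈ Tᶜ, v (σ₂ b) b (l₂ b) := by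
    rw [← Finset.sum_add_sum_compl T]
    congr 1
    · exact Finset.sum_congr rfl fun b hb => by rw [(hr₂T b hb).1, (hr₂T b hb).2]
    · exact Finset.sum_congr rfl fun b hb => by rw [(hr₂ b (Finset.mem_compl.mp hb)).1, (hr₂ b (Finset.mem_compl.mp hb)).2]
  have sq₁d : ∑ i, (d (l₁ i) : ℤ) = ∑ b ∈ T, (d (l₁ b) : ℤ) + ∑ b ∈ Tᶜ, (d (l₁ b) : ℤ) :=
    (Finset.sum_add_sum_compl T _).symm
  have sq₂d : ∑ i, (d (l₂ i) : ℤ) = ∑ b ∈ T, (d (l₂ b) : ℤ) + ∑ b ∈ Tᶜ, (d (l₂ b) : ℤ) :=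
    (Finset.sum_add_sum_compl T _).symm
  have sq₁v : ∑ i, v (σ₁ i) i (l₁ i) = ∑ b ∈ T, v (σ₁ b) b (l₁ b) + ∑ b ∈ Tᶜ, v (σ₁ b) b (l₁ b) :=
    (Finset.sum_add_sum_compl T _).symm
  have sq₂v : ∑ i, v (σ₂ i) i (l₂ i) = ∑ b ∈ T, v (σ₂ b) b (l₂ b) + ∑ b ∈ Tᶜ, v (σ₂ b) b (l₂ b) :=
    (Finset.sum_add_sum_compl T _).symm
  rw [sd₁, sv₁, sq₁d, sq₁v] at hA
  rw [sd₂, sv₂, sq₂d, sq₂v] at hB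
  by_contra hcon
  have hcon' : ∑ b ∈ T, (d (l₂ b) : ℤ) ≤ ∑ b ∈ T, (d (l₁ b) : ℤ) := not_lt.mp hcon
  nlinarith [mul_nonneg (sub_nonneg.mpr hθ.le) (sub_nonneg.mpr hcon')]

/-! ## §2 Invariant column sets: the exchanged terms are built for the user -/

/-- The restriction `π_T` of a permutation `π` to an invariant finset `T` (identity off `T`). -/
theorem exists_perm_restrict {m : ℕ} (π : Equiv.Perm (Fin m)) (T : Finset (Fin m))
    (hT : ∀ b, π b ∈ T ↔ b ∈ T) :
    ∃ πT : Equiv.Perm (Fin m), (∀ b ∈ T, πT b = π b) ∧ (∀ b ∉ T, πT b = b) ∧ (∀ b, πT b ∈ T ↔ b ∈ T) := by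
  classical
  refine ⟨Equiv.Perm.ofSubtype (π.subtypePerm hT), fun b hb => Equiv.Perm.ofSubtype_subtypePerm_of_mem hT hb,
    fun b hb => Equiv.Perm.ofSubtype_subtypePerm_of_not_mem hT hb, fun b => ?_⟩
  exact Equiv.Perm.ofSubtype_apply_mem_iff_mem _ b

/-- **Cyclewise monotonicity (invariant-set form).**  Let `(σ₁, λ₁)` be dominant at `θ₁` and `(σ₂, λ₂)` at `θ₂ > θ₁`, and let
`T` be a column set invariant under the quotient `σ₁⁻¹ σ₂` (a union of its cycles, plus any columns where `σ₁ = σ₂`).  If the two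
terms differ somewhere on `T` (in row or in class), then `∑_{b∈T} d(λ₁ b) < ∑_{b∈T} d(λ₂ b)`: every invariant block of columns on
which the chain moves carries strictly increasing exponent mass. [folklore] -/
theorem sum_d_lt_of_isDominant_invariant {m K : ℕ} (d : Fin K → ℕ) (v ε : Fin m → Fin m → Fin K → ℤ) {θ₁ θ₂ : ℤ}
    (hθ : θ₁ < θ₂) {σ₁ σ₂ : Equiv.Perm (Fin m)} {l₁ l₂ : Fin m → Fin K}
    (h₁ : IsDominant d v ε θ₁ (σ₁, l₁)) (h₂ : IsDominant d v ε θ₂ (σ₂, l₂)) (T : Finset (Fin m))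
    (hT : ∀ b, (σ₁⁻¹ * σ₂) b ∈ T ↔ b ∈ T) (hne : ∃ b ∈ T, σ₁ b ≠ σ₂ b ∨ l₁ b ≠ l₂ b) :
    ∑ b ∈ T, (d (l₁ b) : ℤ) < ∑ b ∈ T, (d (l₂ b) : ℤ) := by
  classical
  obtain ⟨πT, hπT, hπT', hπTmem⟩ := exists_perm_restrict (σ₁⁻¹ * σ₂) T hT
  -- the exchanged terms
  have key := sum_d_lt_of_isDominant_exchange d v ε hθ h₁ h₂ T
    (r₁ := (σ₁ * πT, fun b => if b ∈ T then l₂ b else l₁ b))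
    (r₂ := (σ₂ * πT⁻¹, fun b => if b ∈ T then l₁ b else l₂ b))
  refine key ?_ ?_ ?_ ?_ ?_
  · intro b hb
    refine ⟨?_, by simp [hb]⟩
    show σ₁ (πT b) = σ₂ b
    rw [hπT b hb]; simp
  · intro b hb
    refine ⟨?_, by simp [hb]⟩
    show σ₁ (πT b) = σ₁ b
    rw [hπT' b hb]
  · intro b hb
    refine ⟨?_, by simp [hb]⟩
    show σ₂ (πT⁻¹ b) = σ₁ b
    -- `c := πT⁻¹ b ∈ T` and `π c = b`, i.e. `σ₂ c = σ₁ b`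
    have hc : πT⁻¹ b ∈ T := (hπTmem (πT⁻¹ b)).1 (by simpa using hb)
    have hπc : (σ₁⁻¹ * σ₂) (πT⁻¹ b) = b := by rw [← hπT _ hc]; simp
    rw [Equiv.Perm.mul_apply, Equiv.Perm.inv_eq_iff_eq] at hπc
    exact hπc
  · intro b hb
    refine ⟨?_, by simp [hb]⟩
    show σ₂ (πT⁻¹ b) = σ₂ b
    have : πT⁻¹ b = b := by
      rw [Equiv.Perm.inv_eq_iff_eq]
      exact (hπT' b hb).symm
    rw [this]
  · obtain ⟨b, hb, hdiff⟩ := hne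
    intro hr
    have hfst : σ₁ (πT b) = σ₁ b := by
      have := congrArg (fun r : Equiv.Perm (Fin m) × (Fin m → Fin K) => r.1 b) hr
      simpa [Equiv.Perm.mul_apply] using this
    have hsnd : (if b ∈ T then l₂ b else l₁ b) = l₁ b := by
      have := congrArg (fun r : Equiv.Perm (Fin m) × (Fin m → Fin K) => r.2 b) hr
      simpa using this
    rw [if_pos hb] at hsnd
    have e1 : σ₁ (πT b) = σ₂ b := by rw [hπT b hb]; simp
    rcases hdiff with h | h
    · exact h (e1.symm.trans hfst).symm
    · exact h hsnd.symm

/-- **Splitting form.**  With `T` invariant under `σ₁⁻¹ σ₂`, so is `Tᶜ`; if the two chain terms differ both on `T` and off `T`,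
then the exponent masses on `T` AND on `Tᶜ` both strictly increase — two «digits» moving on disjoint invariant column sets
must each raise the slope between any two terms of a dominant chain. [folklore] -/
theorem sum_d_lt_of_isDominant_split {m K : ℕ} (d : Fin K → ℕ) (v ε : Fin m → Fin m → Fin K → ℤ) {θ₁ θ₂ : ℤ}
    (hθ : θ₁ < θ₂) {σ₁ σ₂ : Equiv.Perm (Fin m)} {l₁ l₂ : Fin m → Fin K}
    (h₁ : IsDominant d v ε θ₁ (σ₁, l₁)) (h₂ : IsDominant d v ε θ₂ (σ₂, l₂)) (T : Finset (Fin m))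
    (hT : ∀ b, (σ₁⁻¹ * σ₂) b ∈ T ↔ b ∈ T) (hin : ∃ b ∈ T, σ₁ b ≠ σ₂ b ∨ l₁ b ≠ l₂ b)
    (hout : ∃ b ∉ T, σ₁ b ≠ σ₂ b ∨ l₁ b ≠ l₂ b) :
    ∑ b ∈ T, (d (l₁ b) : ℤ) < ∑ b ∈ T, (d (l₂ b) : ℤ) ∧
      ∑ b ∈ Tᶜ, (d (l₁ b) : ℤ) < ∑ b ∈ Tᶜ, (d (l₂ b) : ℤ) := by
  refine ⟨sum_d_lt_of_isDominant_invariant d v ε hθ h₁ h₂ T hT hin,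
    sum_d_lt_of_isDominant_invariant d v ε hθ h₁ h₂ Tᶜ (fun b => ?_) ?_⟩
  · rw [Finset.mem_compl, Finset.mem_compl, not_iff_not]
    exact hT b
  · obtain ⟨b, hb, h⟩ := hout
    exact ⟨b, Finset.mem_compl.mpr hb, h⟩

end Summit.ValiantsHypothesis.ValiantsHypothesis.Theorems.KPlusLogSqLaw
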